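import Summits.CriticalPhenomena.PercolationContinuityZ3.Theorems.PercNearOneGluingNoHeavyPcintWinKernelCert
import HarnessLib

/-!
# PCINT lane, kernel B3r window certificate `d = 4`, memory 5 (4-step windows, 4096 codes) — table and chunk check

Cell `prim-pcint`, seat `prim-pcint-2` (gen 2); memo `run/shared/lean/prim/pcint/REDUCTIONS.md` §B3r, INTERVAL-PLAN §14.
Does NOT build on p205010.  Instance data for the generic theorem
`WinK.le_criticalProb_of_checkB`: `p = 1489/10^4`, `s̄ = 9889/10^4 ≥ √(1-p²)`, refund `r = 10113/10^4`, `κ̄ = (10^4+9889)/(2·10^4)`; Collatz–Wielandt vector on the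
23 hyperoctahedral normal forms (integer scale `10^5`, found by power iteration and verified in exact arithmetic
off-line: max row ratio `815583837171207459931/815840000000000000000` < 1; `λ = 99999/10^5`).  The `4096` coded rows are checked by `decide +kernel` in
`…KernZ4B5Check*`; result in `…KernZ4B5`: `p_c^bond(ℤ⁴) ≥ 0.1489`.
-/

namespace Summit.CriticalPhenomena.PercolationContinuityZ3.Theorems.Pcint

namespace Z4B5

/-- The certificate table `normal-form code ↦ v`. [folklore] -/
def tbl : List (ℕ × ℕ) := [(0, 100000), (16, 99724), (128, 96117), (144, 95761), (272, 95091), (592, 97921), (640, 81487), (656, 94422), (784, 92013), (1024, 95761), (1040, 96117), (1104, 96117), (1152, 99724), (1168, 100000), (1296, 96117), (1552, 83357), (1808, 81584), (2064, 95091), (2128, 93354), (2176, 95091), (2192, 95761), (2320, 99724), (3344, 95091)]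

/-- All table values lie in `[81487, 100000]`. [folklore] -/
theorem tbl_bounds : ∀ e ∈ tbl, 81487 ≤ e.2 ∧ e.2 ≤ 100000 := by decide

/-- The Collatz–Wielandt row check on the window codes `[lo, hi)`. [folklore] -/
def chk (lo hi : ℕ) : Bool := WinK.allRange (WinK.rowOKB 4 3 1489 10113 9889 99999 tbl 81487) lo hi

/-- Splitting a chunk check. [folklore] -/
theorem chk_split {lo mid hi : ℕ} (h1 : chk lo mid = true) (h2 : chk mid hi = true) : chk lo hi = true :=
  WinK.allRange_split h1 h2

end Z4B5

end Summit.CriticalPhenomena.PercolationContinuityZ3.Theorems.Pcint
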